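import Summits.QuantumFields.QCD.Theses.SpectralDefectExtinction
import Summits.QuantumFields.QCD.Theorems.ExtinctionBuildsQCD.Negative.ExtinctIntegrable
import Literature.MathematicalPhysics.QuantumLattice.WilsonHopFlatSections

/-!
# Auxiliary lemmas for stub `stub_resonanceLD` (S2d) of line `corner-decorrelation-deep-hole`
(crux `Summit.QuantumFields.QCD.Theses.SpectralDefectExtinction.WindowExtinction`, item stmt-QuantumFields-18063)

Generic, gauge-theory-free pieces of the resonance large-deviation estimate on a box:

* `cornerLD_integral_prod_le_pow` — EXPONENTIAL-MOMENT PEELING: if, for every site `v ∈ S` and every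
  `S' ⊆ S` not containing `v`, the product test function `G = ∏_{u ∈ S'} (1 + t·1_{b u})` satisfies the
  single-site anti-concentration bound `∫ G·1_{b v}·W ≤ δ ∫ G·W`, then `∫ ∏_{v∈S}(1 + t·1_{b v})·W ≤
  (1 + tδ)^{|S|} ∫ W` (induction on `S`);
* `cornerLD_indicator_le_sum` — PIGEONHOLE + MARKOV, pointwise: the indicator of "at least `1/16` of the
  points of `B` are resonant" is bounded by `∑_r s^{-|B_r|} ∏_{v ∈ B_r} (1 + (s¹⁶ − 1)·1_{res v})` over the
  classes `B_r` of any labelling of `B`;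
* `cornerLD_generic` — the two combined with the decay arithmetic (`s = 2`, `δ ≤ 2⁻¹⁷`, `ρ₀ ≤ 3/4 ≤ e^{-1/4}`);
* `cornerLD_pow_le_card_class`, `cornerLD_proj_ne` — combinatorics of the parity classes of an integer box
  `∏ [a_i, a_i + m_i)`, `ℓ ≤ m_i < 2ℓ`, `2ℓ ≤ L`: each class has `≥ ℓ⁴/256` points, and two distinct points
  of one class have torus images `y ≠ y'`, `y ≠ y' + 1̂`;
-/

noncomputable section

namespace Summit.QuantumFields.QCD.Cruxes.WindowExtinction.CornerDecorrelationDeepHole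

open scoped BigOperators Topology Classical Matrix
open Filter MeasureTheory
open Literature.MathematicalPhysics.QuantumLattice Literature.MathematicalPhysics.QuantumFieldTheory
  Literature.Probability.LatticeModels
open Summit.QuantumFields.QCD.Theses.SpectralDefectExtinction

/-! ## Peeling and Markov (abstract measure theory) -/

section Abstract

variable {X σ : Type*} [MeasurableSpace X] {μ : Measure X}

/-- The product test functions `∏_{u∈S} (1 + t·1_{b u})` (`t ≥ 0`) are measurable, nonnegative and
bounded by `(1 + t)^{|S|}`. -/
theorem cornerLD_prod_facts (b : σ → X → Prop) [∀ u x, Decidable (b u x)] {t : ℝ} (ht : 0 ≤ t)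
    (hb : ∀ u, Measurable fun x => if b u x then (1 : ℝ) else 0) (S : Finset σ) :
    Measurable (fun x => ∏ u ∈ S, (1 + t * (if b u x then (1 : ℝ) else 0))) ∧
      (∀ x, 0 ≤ ∏ u ∈ S, (1 + t * (if b u x then (1 : ℝ) else 0))) ∧
      ∀ x, ∏ u ∈ S, (1 + t * (if b u x then (1 : ℝ) else 0)) ≤ (1 + t) ^ S.card := by
  refine ⟨Finset.measurable_prod _ fun u _ => measurable_const.add (measurable_const.mul (hb u)),
    fun x => Finset.prod_nonneg fun u _ => ?_, fun x => ?_⟩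
  · split_ifs <;> nlinarith
  · rw [← Finset.prod_const]
    exact Finset.prod_le_prod (fun u _ => by split_ifs <;> nlinarith)
      (fun u _ => by split_ifs <;> nlinarith)

/-- A product test function times an integrable weight is integrable. -/
theorem cornerLD_integrable_prod_mul {W : X → ℝ} (hWi : Integrable W μ) (b : σ → X → Prop)
    [∀ u x, Decidable (b u x)] {t : ℝ} (ht : 0 ≤ t)
    (hb : ∀ u, Measurable fun x => if b u x then (1 : ℝ) else 0) (S : Finset σ) :
    Integrable (fun x => (∏ u ∈ S, (1 + t * (if b u x then (1 : ℝ) else 0))) * W x) μ := by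
  obtain ⟨hm, h0, hle⟩ := cornerLD_prod_facts b ht hb S
  refine hWi.bdd_mul hm.aestronglyMeasurable (c := (1 + t) ^ S.card) (ae_of_all _ fun x => ?_)
  rw [Real.norm_eq_abs, abs_of_nonneg (h0 x)]
  exact hle x

/-- A product test function times an indicator times an integrable weight is integrable. -/
theorem cornerLD_integrable_prod_ind_mul {W : X → ℝ} (hWi : Integrable W μ) (b : σ → X → Prop)
    [∀ u x, Decidable (b u x)] {t : ℝ} (ht : 0 ≤ t)
    (hb : ∀ u, Measurable fun x => if b u x then (1 : ℝ) else 0) (S : Finset σ) (v : σ) :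
    Integrable (fun x => (∏ u ∈ S, (1 + t * (if b u x then (1 : ℝ) else 0))) *
      (if b v x then (1 : ℝ) else 0) * W x) μ := by
  obtain ⟨hm, h0, hle⟩ := cornerLD_prod_facts b ht hb S
  refine hWi.bdd_mul (hm.mul (hb v)).aestronglyMeasurable (c := (1 + t) ^ S.card)
    (ae_of_all _ fun x => ?_)
  rw [Real.norm_eq_abs, abs_of_nonneg (mul_nonneg (h0 x) (by split_ifs <;> norm_num))]
  have h1 : (if b v x then (1 : ℝ) else 0) ≤ 1 := by split_ifs <;> norm_num
  calc (∏ u ∈ S, (1 + t * (if b u x then (1 : ℝ) else 0))) * (if b v x then (1 : ℝ) else 0)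
      ≤ (1 + t) ^ S.card * 1 :=
        mul_le_mul (hle x) h1 (by split_ifs <;> norm_num) (pow_nonneg (by linarith) _)
    _ = (1 + t) ^ S.card := mul_one _

/-- **Exponential-moment peeling.**  If for every `v ∈ S` and every `S' ⊆ S` avoiding `v` the product
test function `G = ∏_{u∈S'}(1 + t·1_{b u})` obeys the one-site anti-concentration bound
`∫ G·1_{b v}·W ≤ δ ∫ G·W`, then `∫ ∏_{v ∈ S}(1 + t·1_{b v})·W ≤ (1 + tδ)^{|S|} ∫ W`. -/
theorem cornerLD_integral_prod_le_pow [DecidableEq σ] {W : X → ℝ} (hWi : Integrable W μ)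
    (b : σ → X → Prop) [∀ u x, Decidable (b u x)] {t δ : ℝ} (ht : 0 ≤ t) (hδ : 0 ≤ δ)
    (hb : ∀ u, Measurable fun x => if b u x then (1 : ℝ) else 0) (S : Finset σ)
    (hyp : ∀ v ∈ S, ∀ S' ⊆ S, v ∉ S' →
      ∫ x, (∏ u ∈ S', (1 + t * (if b u x then (1 : ℝ) else 0))) * (if b v x then (1 : ℝ) else 0) *
          W x ∂μ ≤
        δ * ∫ x, (∏ u ∈ S', (1 + t * (if b u x then (1 : ℝ) else 0))) * W x ∂μ) :
    ∫ x, (∏ u ∈ S, (1 + t * (if b u x then (1 : ℝ) else 0))) * W x ∂μ ≤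
      (1 + t * δ) ^ S.card * ∫ x, W x ∂μ := by
  suffices h : ∀ T : Finset σ, T ⊆ S →
      ∫ x, (∏ u ∈ T, (1 + t * (if b u x then (1 : ℝ) else 0))) * W x ∂μ ≤
        (1 + t * δ) ^ T.card * ∫ x, W x ∂μ from h S Finset.Subset.rfl
  intro T
  induction T using Finset.induction_on with
  | empty => intro; simp
  | insert v T hv ih =>
    intro hTS
    have hvS : v ∈ S := hTS (Finset.mem_insert_self v T)
    have hT : T ⊆ S := (Finset.subset_insert v T).trans hTS
    have ih' := ih hT
    have hstep := hyp v hvS T hT hv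
    have hsplit : ∀ x, (∏ u ∈ insert v T, (1 + t * (if b u x then (1 : ℝ) else 0))) * W x =
        (∏ u ∈ T, (1 + t * (if b u x then (1 : ℝ) else 0))) * W x +
          t * ((∏ u ∈ T, (1 + t * (if b u x then (1 : ℝ) else 0))) *
            (if b v x then (1 : ℝ) else 0) * W x) := by
      intro x
      rw [Finset.prod_insert hv]
      ring
    calc ∫ x, (∏ u ∈ insert v T, (1 + t * (if b u x then (1 : ℝ) else 0))) * W x ∂μ
        = ∫ x, ((∏ u ∈ T, (1 + t * (if b u x then (1 : ℝ) else 0))) * W x +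
            t * ((∏ u ∈ T, (1 + t * (if b u x then (1 : ℝ) else 0))) *
              (if b v x then (1 : ℝ) else 0) * W x)) ∂μ :=
          integral_congr_ae (ae_of_all _ hsplit)
      _ = ∫ x, (∏ u ∈ T, (1 + t * (if b u x then (1 : ℝ) else 0))) * W x ∂μ +
            t * ∫ x, (∏ u ∈ T, (1 + t * (if b u x then (1 : ℝ) else 0))) *
              (if b v x then (1 : ℝ) else 0) * W x ∂μ := by
          rw [integral_add (cornerLD_integrable_prod_mul hWi b ht hb T)
            ((cornerLD_integrable_prod_ind_mul hWi b ht hb T v).const_mul t), integral_const_mul]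
      _ ≤ (1 + t * δ) ^ T.card * ∫ x, W x ∂μ +
            t * (δ * ∫ x, (∏ u ∈ T, (1 + t * (if b u x then (1 : ℝ) else 0))) * W x ∂μ) :=
          add_le_add ih' (mul_le_mul_of_nonneg_left hstep ht)
      _ ≤ (1 + t * δ) ^ T.card * ∫ x, W x ∂μ +
            t * (δ * ((1 + t * δ) ^ T.card * ∫ x, W x ∂μ)) :=
          add_le_add le_rfl (mul_le_mul_of_nonneg_left (mul_le_mul_of_nonneg_left ih' hδ) ht)
      _ = (1 + t * δ) ^ (insert v T).card * ∫ x, W x ∂μ := by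
          rw [Finset.card_insert_of_notMem hv, pow_succ]
          ring

/-- **Pigeonhole over classes + Markov, pointwise.**  For a finite set `B` of sites labelled by `cls`, a
predicate `p` ("resonant") and `s ≥ 1`: if `K ≥ |B|`, the indicator of `K ≤ 16·#{v ∈ B : p v}` is at most
`∑_r s^{-|B_r|} ∏_{v∈B_r} (1 + (s¹⁶ − 1)·1_{p v})`, `B_r` the class of label `r` (some class has at least
`1/16` of ITS points resonant, and there the product is `s^{16·#res} ≥ s^{|B_r|}`). -/
theorem cornerLD_indicator_le_sum {τ κ : Type*} [Fintype κ] [Nonempty κ] [DecidableEq κ]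
    (B : Finset τ) (cls : τ → κ) (p : τ → Prop) [DecidablePred p] {s : ℝ} (hs : 1 ≤ s) {K : ℕ}
    (hK : B.card ≤ K) :
    (if K ≤ 16 * (B.filter p).card then (1 : ℝ) else 0) ≤
      ∑ r, (s ^ (B.filter (fun v => cls v = r)).card)⁻¹ *
        ∏ v ∈ B.filter (fun v => cls v = r), (1 + (s ^ 16 - 1) * (if p v then (1 : ℝ) else 0)) := by
  have hs16 : (1 : ℝ) ≤ s ^ 16 := one_le_pow₀ hs
  have hterm : ∀ r, 0 ≤ (s ^ (B.filter (fun v => cls v = r)).card)⁻¹ *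
      ∏ v ∈ B.filter (fun v => cls v = r), (1 + (s ^ 16 - 1) * (if p v then (1 : ℝ) else 0)) := by
    intro r
    refine mul_nonneg (inv_nonneg.2 (pow_nonneg (by linarith) _)) (Finset.prod_nonneg fun v _ => ?_)
    split_ifs <;> linarith
  split_ifs with hE
  · have hcardB : B.card = ∑ r, (B.filter (fun v => cls v = r)).card :=
      Finset.card_eq_sum_card_fiberwise (f := cls) (t := Finset.univ) fun _ _ => Finset.mem_coe.2 (Finset.mem_univ _)
    have hcardR : (B.filter p).card = ∑ r, ((B.filter (fun v => cls v = r)).filter p).card := by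
      rw [Finset.card_eq_sum_card_fiberwise (f := cls) (s := B.filter p) (t := Finset.univ)
        fun _ _ => Finset.mem_coe.2 (Finset.mem_univ _)]
      refine Finset.sum_congr rfl fun r _ => ?_
      rw [Finset.filter_filter, Finset.filter_filter]
      exact congrArg Finset.card (Finset.filter_congr fun v _ => and_comm)
    obtain ⟨r, hr⟩ : ∃ r, (B.filter (fun v => cls v = r)).card ≤
        16 * ((B.filter (fun v => cls v = r)).filter p).card := by
      by_contra hcon
      push Not at hcon
      have hlt : ∑ r, 16 * ((B.filter (fun v => cls v = r)).filter p).card <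
          ∑ r, (B.filter (fun v => cls v = r)).card :=
        Finset.sum_lt_sum_of_nonempty Finset.univ_nonempty fun r _ => hcon r
      rw [← Finset.mul_sum, ← hcardR, ← hcardB] at hlt
      omega
    have hprod : ∏ v ∈ B.filter (fun v => cls v = r), (1 + (s ^ 16 - 1) * (if p v then (1 : ℝ) else 0)) =
        (s ^ 16) ^ ((B.filter (fun v => cls v = r)).filter p).card := by
      have h1 : ∀ v, (1 + (s ^ 16 - 1) * (if p v then (1 : ℝ) else 0)) = if p v then s ^ 16 else 1 :=
        fun v => by split_ifs <;> ring
      simp_rw [h1]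
      rw [Finset.prod_ite, Finset.prod_const_one, mul_one, Finset.prod_const]
    calc (1 : ℝ) ≤ (s ^ (B.filter (fun v => cls v = r)).card)⁻¹ *
          ∏ v ∈ B.filter (fun v => cls v = r), (1 + (s ^ 16 - 1) * (if p v then (1 : ℝ) else 0)) := by
          rw [hprod, ← pow_mul, le_inv_mul_iff₀ (pow_pos (by linarith) _), mul_one]
          exact pow_le_pow_right₀ hs hr
      _ ≤ ∑ r', (s ^ (B.filter (fun v => cls v = r')).card)⁻¹ *
          ∏ v ∈ B.filter (fun v => cls v = r'), (1 + (s ^ 16 - 1) * (if p v then (1 : ℝ) else 0)) :=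
          Finset.single_le_sum (fun r' _ => hterm r') (Finset.mem_univ r)
  · exact Finset.sum_nonneg fun r _ => hterm r

/-- Decay arithmetic: with `δ ≤ 2⁻¹⁷` and `Λ ≤ 256 n`, `2^{-n} (1 + (2¹⁶ − 1)δ)^n ≤ (3/4)^n ≤ e^{-n/4} ≤
e^{-Λ/1024}`. -/
theorem cornerLD_decay {δ Λ I : ℝ} (hδ0 : 0 ≤ δ) (hδ : δ ≤ 1 / 2 ^ 17) (hI : 0 ≤ I) {n : ℕ}
    (hn : Λ ≤ 256 * n) :
    ((2 : ℝ) ^ n)⁻¹ * ((1 + ((2 : ℝ) ^ 16 - 1) * δ) ^ n * I) ≤ Real.exp (-(1 / 1024 * Λ)) * I := by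
  have h2 : (2 : ℝ)⁻¹ * (1 + ((2 : ℝ) ^ 16 - 1) * δ) ≤ Real.exp (-(1 / 4)) := by
    have h3 : ((2 : ℝ) ^ 16 - 1) * δ ≤ ((2 : ℝ) ^ 16 - 1) * (1 / 2 ^ 17) :=
      mul_le_mul_of_nonneg_left hδ (by norm_num)
    have h4 := Real.add_one_le_exp (-(1 / 4 : ℝ))
    nlinarith
  have h5 : ((2 : ℝ)⁻¹ * (1 + ((2 : ℝ) ^ 16 - 1) * δ)) ^ n ≤ Real.exp (-(1 / 4)) ^ n :=
    pow_le_pow_left₀ (mul_nonneg (by norm_num) (by positivity)) h2 n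
  rw [← Real.exp_nat_mul] at h5
  have h6 : Real.exp (n * -(1 / 4 : ℝ)) ≤ Real.exp (-(1 / 1024 * Λ)) := Real.exp_le_exp.2 (by linarith)
  calc ((2 : ℝ) ^ n)⁻¹ * ((1 + ((2 : ℝ) ^ 16 - 1) * δ) ^ n * I)
      = ((2 : ℝ)⁻¹ * (1 + ((2 : ℝ) ^ 16 - 1) * δ)) ^ n * I := by rw [mul_pow, inv_pow]; ring
    _ ≤ Real.exp (-(1 / 1024 * Λ)) * I := mul_le_mul_of_nonneg_right (h5.trans h6) hI

/-- **Generic resonance large deviation.**  Peeling (`cornerLD_integral_prod_le_pow`, per class) +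
pigeonhole/Markov (`cornerLD_indicator_le_sum`, `s = 2`) + decay arithmetic: if every class `B_r` has
`≥ Λ/256` points and satisfies the one-site anti-concentration hypothesis with `δ ≤ 2⁻¹⁷`, then
`∫ 1[K ≤ 16·#res(B)]·W ≤ |κ| e^{-Λ/1024} ∫ W` for every `K ≥ |B|`. -/
theorem cornerLD_generic {κ : Type*} [Fintype κ] [Nonempty κ] [DecidableEq κ] [DecidableEq σ]
    {W : X → ℝ} (hW0 : ∀ x, 0 ≤ W x) (hWi : Integrable W μ)
    (b : σ → X → Prop) [∀ u x, Decidable (b u x)]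
    (hb : ∀ u, Measurable fun x => if b u x then (1 : ℝ) else 0)
    (B : Finset σ) (cls : σ → κ) {δ Λ : ℝ} (hδ0 : 0 ≤ δ) (hδ : δ ≤ 1 / 2 ^ 17) {K : ℕ} (hK : B.card ≤ K)
    (hΛ : ∀ r, Λ ≤ 256 * ((B.filter (fun v => cls v = r)).card : ℝ))
    (hyp : ∀ r, ∀ v ∈ B.filter (fun v => cls v = r), ∀ S' ⊆ B.filter (fun v => cls v = r), v ∉ S' →
      ∫ x, (∏ u ∈ S', (1 + ((2 : ℝ) ^ 16 - 1) * (if b u x then (1 : ℝ) else 0))) *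
          (if b v x then (1 : ℝ) else 0) * W x ∂μ ≤
        δ * ∫ x, (∏ u ∈ S', (1 + ((2 : ℝ) ^ 16 - 1) * (if b u x then (1 : ℝ) else 0))) * W x ∂μ) :
    ∫ x, (if K ≤ 16 * (B.filter (fun v => b v x)).card then (1 : ℝ) else 0) * W x ∂μ ≤
      Fintype.card κ * Real.exp (-(1 / 1024 * Λ)) * ∫ x, W x ∂μ := by
  have ht : (0 : ℝ) ≤ (2 : ℝ) ^ 16 - 1 := by norm_num
  -- peeling, class by class
  have hpeel : ∀ r, ∫ x, (∏ u ∈ B.filter (fun v => cls v = r),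
      (1 + ((2 : ℝ) ^ 16 - 1) * (if b u x then (1 : ℝ) else 0))) * W x ∂μ ≤
      (1 + ((2 : ℝ) ^ 16 - 1) * δ) ^ (B.filter (fun v => cls v = r)).card * ∫ x, W x ∂μ := fun r =>
    cornerLD_integral_prod_le_pow hWi b ht hδ0 hb _ (hyp r)
  -- pointwise pigeonhole/Markov bound
  have hpt : ∀ x, (if K ≤ 16 * (B.filter (fun v => b v x)).card then (1 : ℝ) else 0) * W x ≤
      (∑ r, ((2 : ℝ) ^ (B.filter (fun v => cls v = r)).card)⁻¹ *
        ∏ v ∈ B.filter (fun v => cls v = r), (1 + ((2 : ℝ) ^ 16 - 1) * (if b v x then (1 : ℝ) else 0))) *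
        W x := fun x =>
    mul_le_mul_of_nonneg_right (cornerLD_indicator_le_sum B cls (fun v => b v x) (s := 2) (by norm_num) hK)
      (hW0 x)
  have hGi : ∀ r, Integrable (fun x => (∏ u ∈ B.filter (fun v => cls v = r),
      (1 + ((2 : ℝ) ^ 16 - 1) * (if b u x then (1 : ℝ) else 0))) * W x) μ := fun r =>
    cornerLD_integrable_prod_mul hWi b ht hb _
  have hI : 0 ≤ ∫ x, W x ∂μ := integral_nonneg hW0
  calc ∫ x, (if K ≤ 16 * (B.filter (fun v => b v x)).card then (1 : ℝ) else 0) * W x ∂μ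
      ≤ ∫ x, (∑ r, ((2 : ℝ) ^ (B.filter (fun v => cls v = r)).card)⁻¹ *
          ∏ v ∈ B.filter (fun v => cls v = r), (1 + ((2 : ℝ) ^ 16 - 1) * (if b v x then (1 : ℝ) else 0))) *
          W x ∂μ := by
        refine integral_mono_of_nonneg (ae_of_all _ fun x => mul_nonneg (by positivity) (hW0 x)) ?_
          (ae_of_all _ hpt)
        have heq : (fun x => (∑ r, ((2 : ℝ) ^ (B.filter (fun v => cls v = r)).card)⁻¹ *
            ∏ v ∈ B.filter (fun v => cls v = r), (1 + ((2 : ℝ) ^ 16 - 1) * (if b v x then (1 : ℝ) else 0))) *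
            W x) = fun x => ∑ r, ((2 : ℝ) ^ (B.filter (fun v => cls v = r)).card)⁻¹ *
            ((∏ v ∈ B.filter (fun v => cls v = r),
              (1 + ((2 : ℝ) ^ 16 - 1) * (if b v x then (1 : ℝ) else 0))) * W x) := by
          funext x; rw [Finset.sum_mul]; exact Finset.sum_congr rfl fun r _ => mul_assoc _ _ _
        rw [heq]
        exact integrable_finsetSum _ fun r _ => (hGi r).const_mul _
    _ = ∑ r, ∫ x, ((2 : ℝ) ^ (B.filter (fun v => cls v = r)).card)⁻¹ *
          ((∏ v ∈ B.filter (fun v => cls v = r),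
            (1 + ((2 : ℝ) ^ 16 - 1) * (if b v x then (1 : ℝ) else 0))) * W x) ∂μ := by
        rw [← integral_finsetSum _ fun r _ => (hGi r).const_mul _]
        refine integral_congr_ae (ae_of_all _ fun x => ?_)
        beta_reduce
        rw [Finset.sum_mul]
        exact Finset.sum_congr rfl fun r _ => mul_assoc _ _ _
    _ = ∑ r, ((2 : ℝ) ^ (B.filter (fun v => cls v = r)).card)⁻¹ *
          ∫ x, (∏ v ∈ B.filter (fun v => cls v = r),
            (1 + ((2 : ℝ) ^ 16 - 1) * (if b v x then (1 : ℝ) else 0))) * W x ∂μ :=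
        Finset.sum_congr rfl fun r _ => integral_const_mul _ _
    _ ≤ ∑ r, ((2 : ℝ) ^ (B.filter (fun v => cls v = r)).card)⁻¹ *
          ((1 + ((2 : ℝ) ^ 16 - 1) * δ) ^ (B.filter (fun v => cls v = r)).card * ∫ x, W x ∂μ) :=
        Finset.sum_le_sum fun r _ => mul_le_mul_of_nonneg_left (hpeel r) (inv_nonneg.2 (pow_nonneg (by norm_num) _))
    _ ≤ ∑ _r : κ, Real.exp (-(1 / 1024 * Λ)) * ∫ x, W x ∂μ :=
        Finset.sum_le_sum fun r _ => cornerLD_decay hδ0 hδ hI (hΛ r)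
    _ = Fintype.card κ * Real.exp (-(1 / 1024 * Λ)) * ∫ x, W x ∂μ := by
        rw [Finset.sum_const, Finset.card_univ, nsmul_eq_mul, mul_assoc]

end Abstract

/-! ## Parity classes of an integer box -/

section Box

/-- **Every parity class of a box with sides `≥ ℓ ≥ 2` has at least `ℓ⁴/256` points**: the class of
label `r` contains the injective image `k ↦ (a'_i + 2k_i)_i` of `∏_i [0, ⌊m_i/2⌋)`, where `a'_i ∈ {a_i, a_i+1}`
has parity `r_i`, and `4⌊m_i/2⌋ ≥ ℓ`. -/
theorem cornerLD_pow_le_card_class (a : Fin 4 → ℤ) (m : Fin 4 → ℕ) {ℓ : ℕ} (hℓ : 2 ≤ ℓ)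
    (hm : ∀ i, ℓ ≤ m i) (cls : (Fin 4 → ℤ) → (Fin 4 → ZMod 2))
    (hcls : ∀ v i, cls v i = ((v i : ℤ) : ZMod 2)) (r : Fin 4 → ZMod 2) :
    ℓ ^ 4 ≤ 256 * ((Fintype.piFinset fun i => Finset.Ico (a i) (a i + m i)).filter
      (fun v => cls v = r)).card := by
  -- a corner of the right parity
  set a' : Fin 4 → ℤ := fun i => if ((a i : ℤ) : ZMod 2) = r i then a i else a i + 1 with ha'
  have key : ∀ x y : ZMod 2, x ≠ y → x + 1 = y := by decide
  have ha'r : ∀ i, ((a' i : ℤ) : ZMod 2) = r i := by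
    intro i
    simp only [ha']
    split_ifs with h
    · exact h
    · push_cast
      exact key _ _ h
  have ha'b : ∀ i, a i ≤ a' i ∧ a' i ≤ a i + 1 := fun i => by
    simp only [ha']; split_ifs <;> constructor <;> omega
  -- the injection
  set f : (Fin 4 → ℕ) → (Fin 4 → ℤ) := fun k i => a' i + 2 * (k i : ℤ) with hf
  have hmaps : Set.MapsTo f ↑(Fintype.piFinset fun i => Finset.range (m i / 2))
      ↑((Fintype.piFinset fun i => Finset.Ico (a i) (a i + m i)).filter (fun v => cls v = r)) := by
    intro k hk
    rw [Finset.mem_coe, Fintype.mem_piFinset] at hk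
    rw [Finset.mem_coe, Finset.mem_filter, Fintype.mem_piFinset]
    refine ⟨fun i => ?_, funext fun i => ?_⟩
    · have hki := Finset.mem_range.1 (hk i)
      have h2 : 2 * (k i) + 2 ≤ m i := by omega
      have hb := ha'b i
      rw [Finset.mem_Ico]
      simp only [hf]
      constructor <;> omega
    · rw [hcls]
      simp only [hf]
      push_cast
      rw [ha'r i]
      have h2 : (2 : ZMod 2) = 0 := by decide
      rw [h2, zero_mul, add_zero]
  have hinj : Set.InjOn f ↑(Fintype.piFinset fun i => Finset.range (m i / 2)) := by
    intro k _ k' _ hkk'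
    funext i
    have := congrFun hkk' i
    simp only [hf] at this
    omega
  have hcard : (Fintype.piFinset fun i => Finset.range (m i / 2)).card = ∏ i, (m i / 2) := by
    rw [Fintype.card_piFinset]
    simp only [Finset.card_range]
  have h4 : ∀ i, ℓ ≤ 4 * (m i / 2) := fun i => by have := hm i; omega
  calc ℓ ^ 4 = ∏ _i : Fin 4, ℓ := by simp
    _ ≤ ∏ i : Fin 4, 4 * (m i / 2) := Finset.prod_le_prod (fun i _ => Nat.zero_le _) fun i _ => h4 i
    _ = 256 * (Fintype.piFinset fun i => Finset.range (m i / 2)).card := by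
        rw [hcard, Finset.prod_mul_distrib]
        simp
    _ ≤ 256 * ((Fintype.piFinset fun i => Finset.Ico (a i) (a i + m i)).filter (fun v => cls v = r)).card :=
        Nat.mul_le_mul_left _ (Finset.card_le_card_of_injOn f hmaps hinj)

/-- **Two distinct points of one parity class of a box of sides `< 2ℓ ≤ L` have torus images `y, y'` with
`y ≠ y'` and `y ≠ y' + 1̂`**: all coordinate differences are even and of modulus `< 2ℓ − 1 < L`. -/
theorem cornerLD_proj_ne {L ℓ : ℕ} (hL : 2 * ℓ ≤ L) (a : Fin 4 → ℤ) (m : Fin 4 → ℕ)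
    (hm : ∀ i, m i < 2 * ℓ) (cls : (Fin 4 → ℤ) → (Fin 4 → ZMod 2))
    (hcls : ∀ v i, cls v i = ((v i : ℤ) : ZMod 2)) {v w : Fin 4 → ℤ}
    (hv : v ∈ Fintype.piFinset fun i => Finset.Ico (a i) (a i + m i))
    (hw : w ∈ Fintype.piFinset fun i => Finset.Ico (a i) (a i + m i))
    (hvw : cls v = cls w) (hne : v ≠ w) :
    Torus.proj L v ≠ Torus.proj L w ∧ Torus.proj L v ≠ Torus.proj L w + Pi.single 1 1 := by
  rw [Fintype.mem_piFinset] at hv hw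
  have hpar : ∀ i, (2 : ℤ) ∣ w i - v i := fun i => by
    have h := congrFun hvw i
    rw [hcls, hcls] at h
    exact (ZMod.intCast_eq_intCast_iff_dvd_sub (v i) (w i) 2).1 h
  constructor
  · intro h
    apply hne
    funext i
    have hi := congrFun h i
    simp only [Torus.proj_apply] at hi
    have hdvd : (L : ℤ) ∣ w i - v i := (ZMod.intCast_eq_intCast_iff_dvd_sub _ _ _).1 hi
    have hlt : |w i - v i| < L := by
      have h1 := Finset.mem_Ico.1 (hv i)
      have h2 := Finset.mem_Ico.1 (hw i)
      have h3 := hm i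
      rw [abs_lt]
      constructor <;> omega
    have h0 : w i - v i = 0 := Int.eq_zero_of_abs_lt_dvd hdvd hlt
    omega
  · intro h
    have hi := congrFun h 1
    simp only [Torus.proj_apply, Pi.add_apply, Pi.single_eq_same] at hi
    have hi' : ((v 1 : ℤ) : ZMod L) = ((w 1 + 1 : ℤ) : ZMod L) := by push_cast; exact hi
    have hdvd : (L : ℤ) ∣ (w 1 + 1) - v 1 := (ZMod.intCast_eq_intCast_iff_dvd_sub _ _ _).1 hi'
    have hlt : |(w 1 + 1) - v 1| < L := by
      have h1 := Finset.mem_Ico.1 (hv 1)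
      have h2 := Finset.mem_Ico.1 (hw 1)
      have h3 := hm 1
      rw [abs_lt]
      constructor <;> omega
    have h0 := Int.eq_zero_of_abs_lt_dvd hdvd hlt
    have h2 := hpar 1
    omega

end Box

end Summit.QuantumFields.QCD.Cruxes.WindowExtinction.CornerDecorrelationDeepHole

end
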